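import Summits.QuantumFields.YangMills.Theorems.SwapVirialDeficitZeroModeSigmaFourSmallBallRateCuts
import HarnessLib

/-!
# Exact zero-mode rung Z5 — toward the POWER RATE of the σ-twisted four-leader small ball, measure side V: the eight pieces against the dominator
# (free-hands support of ⟨stmt-QuantumFields-24197⟩; split with w3 g63: deterministic Taylor package ✓`…SmallBallTaylor`, measure side w2 g56)

The dominator `sigmaDom A ((x,y),z) = sigmaDomXY A (x,y)·𝟙_zBox(z)·e⁴` (✓`sigmaDom_eq`) is majorised in the pair frame by `FdomS` (✓`sigmaDomXY_le_FdomS`).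
* §L transfer: ★ `lintegral_xyCut_sigmaDom_le` — a cut on `(x, y)` read through ✓`pairCoord`: `∫𝟙{pairCoord(x,y) ∈ S}·sigmaDom ≤ (∫𝟙_S·FdomS)·16e⁴`;
  ★ `lintegral_zCut_sigmaDom_le` — a cut on `z`: `≤ 4B·vol(Z ∩ zBox)·e⁴`; the `z`-volumes `volume_zRatio_inter_zBox_le` (`{c·z₀² < ‖ζ‖²}`: `≤ 2√(3/c)·8`)
  and `volume_zLayer_inter_zBox_le` (`{1 − s²‖ζ‖² ≤ z₀² < 1}`: `≤ 2√(3s²)·8`);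
* §M ★★ the eight pieces of ✓`flip_subset` in `w`-space against `sigmaDom A` (`A` axial unit, `αβ ≠ 0`): small axial parts `≤ 4ε·B·E`, large transverse parts
  `≤ 4T^{−p}·M_p·E`, ball-flip layers `≤ 4(s²)^p·M_p·E` (`E = 16e⁴`, `M_p = 2·(2(4/(α²β⁴))^p)·B`), the slaved ratio cut and the slaved layer.
HONEST LABEL: finite-dimensional real analysis (plan-level zero-mode rung of a DRAFT line «sharp-sigma»); NOT the fixed-`L` sharp law, NOT ⟨24197⟩; the
Yang–Mills mass gap is NOT proved; no summit is proved by a line.  Width seat ym-line-sfw-p2-w2 g56 (cell ym-idea-1, free hands; own crux ⟨22884⟩ blocked-on ⟨19935⟩),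
`--supports stmt-QuantumFields-24197`.  THEOREMS ONLY, standard axioms, 0 `sorry`.  References: [cite: Luscher1983, §2]; [cite: Vanbaal2001]; [folklore].
-/

set_option autoImplicit false

noncomputable section

open MeasureTheory Quaternion Set Filter Topology
open scoped Quaternion ENNReal BigOperators
open Literature.MathematicalPhysics.QuantumLattice
open Summit.QuantumFields.YangMills.Theorems.SwapTwistDeficit.ToronLog
open Summit.QuantumFields.YangMills.Theorems.SwapVirialDeficit.ZeroModeGroup

attribute [local instance] Literature.Analysis.FluidPDE.Tao2016.quatMeasurableSpace
  Literature.Analysis.FluidPDE.Tao2016.quatBorelSpace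

namespace Summit.QuantumFields.YangMills.Theorems.SwapVirialDeficit.ZeroModeSigma

/-! ## §L Transfer of cuts to the pair frame and to the slaved-letter box -/

/-- The slaved-letter factor integrates to `16·e⁴` on a set `Z`: `∫ 𝟙_Z·𝟙_zBox·e⁴ = vol(Z ∩ zBox)·e⁴`. [folklore] -/
theorem lintegral_zFactor_eq {Z : Set ℍ} (hZ : MeasurableSet Z) :
    ∫⁻ z : ℍ, Z.indicator (fun _ => (1 : ℝ≥0∞)) z * (zBox.indicator (fun _ => (1 : ℝ≥0∞)) z * ENNReal.ofReal (Real.exp 4)) =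
      volume (Z ∩ zBox) * ENNReal.ofReal (Real.exp 4) := by
  have e : ∀ z : ℍ, Z.indicator (fun _ => (1 : ℝ≥0∞)) z * (zBox.indicator (fun _ => (1 : ℝ≥0∞)) z * ENNReal.ofReal (Real.exp 4)) =
      (Z ∩ zBox).indicator (fun _ => (1 : ℝ≥0∞)) z * ENNReal.ofReal (Real.exp 4) := by
    intro z
    by_cases h1 : z ∈ Z
    · by_cases h2 : z ∈ zBox
      · rw [indicator_of_mem h1, indicator_of_mem h2, indicator_of_mem (Set.mem_inter h1 h2), one_mul]
      · have hn : z ∉ Z ∩ zBox := fun h => h2 (Set.mem_of_mem_inter_right h)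
        simp only [indicator_of_notMem h2, indicator_of_notMem hn, zero_mul, mul_zero]
    · have hn : z ∉ Z ∩ zBox := fun h => h1 (Set.mem_of_mem_inter_left h)
      simp only [indicator_of_notMem h1, indicator_of_notMem hn, zero_mul]
  simp_rw [e]
  rw [lintegral_mul_const _ (measurable_const.indicator (hZ.inter measurableSet_zBox)), lintegral_indicator (hZ.inter measurableSet_zBox),
    setLIntegral_const, one_mul]

/-- ★ **Transfer of an `(x,y)`-cut**: `∫ 𝟙{pairCoord (x,y) ∈ S}·sigmaDom A ≤ (∫ 𝟙_S·FdomS(α,β))·16e⁴` (`α = A₀`, `β = A_I`). [folklore] -/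
theorem lintegral_xyCut_sigmaDom_le (A : ℍ) {S : Set ((ℝ × ℝ) × ((ℝ × ℝ) × ((ℝ × ℝ) × (ℝ × ℝ))))} (hS : MeasurableSet S) :
    ∫⁻ w, {w : (ℍ × ℍ) × ℍ | pairCoord w.1 ∈ S}.indicator (fun _ => (1 : ℝ≥0∞)) w * sigmaDom A w ∂vol3 ≤
      (∫⁻ u, S.indicator (fun _ => (1 : ℝ≥0∞)) u * FdomS A.re A.imI u) * (16 * ENNReal.ofReal (Real.exp 4)) := by
  have hpc : Measurable pairCoord := measurePreserving_pairCoord.measurable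
  have hf : Measurable fun z : ℍ × ℍ => (pairCoord ⁻¹' S).indicator (fun _ => (1 : ℝ≥0∞)) z * sigmaDomXY A z :=
    (measurable_const.indicator (hS.preimage hpc)).mul (measurable_sigmaDomXY A)
  have hg : Measurable fun z : ℍ => zBox.indicator (fun _ => (1 : ℝ≥0∞)) z * ENNReal.ofReal (Real.exp 4) :=
    (measurable_const.indicator measurableSet_zBox).mul measurable_const
  have e : ∀ w : (ℍ × ℍ) × ℍ, {w : (ℍ × ℍ) × ℍ | pairCoord w.1 ∈ S}.indicator (fun _ => (1 : ℝ≥0∞)) w * sigmaDom A w =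
      ((pairCoord ⁻¹' S).indicator (fun _ => (1 : ℝ≥0∞)) w.1 * sigmaDomXY A w.1) * (zBox.indicator (fun _ => (1 : ℝ≥0∞)) w.2 * ENNReal.ofReal (Real.exp 4)) := by
    intro w
    rw [sigmaDom_eq]
    have : {w : (ℍ × ℍ) × ℍ | pairCoord w.1 ∈ S}.indicator (fun _ => (1 : ℝ≥0∞)) w = (pairCoord ⁻¹' S).indicator (fun _ => (1 : ℝ≥0∞)) w.1 := by
      by_cases h : pairCoord w.1 ∈ S
      · rw [indicator_of_mem (show w ∈ {w : (ℍ × ℍ) × ℍ | pairCoord w.1 ∈ S} from h), indicator_of_mem (show w.1 ∈ pairCoord ⁻¹' S from h)]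
      · rw [indicator_of_notMem (show w ∉ {w : (ℍ × ℍ) × ℍ | pairCoord w.1 ∈ S} from h), indicator_of_notMem (show w.1 ∉ pairCoord ⁻¹' S from h)]
    rw [this]; ring
  simp_rw [e]
  rw [vol3_def, lintegral_prod_mul hf.aemeasurable hg.aemeasurable]
  have hz : ∫⁻ z : ℍ, zBox.indicator (fun _ => (1 : ℝ≥0∞)) z * ENNReal.ofReal (Real.exp 4) = 16 * ENNReal.ofReal (Real.exp 4) := by
    rw [lintegral_mul_const _ (measurable_const.indicator measurableSet_zBox), lintegral_indicator measurableSet_zBox, setLIntegral_const, one_mul, volume_zBox]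
  rw [hz]
  refine mul_le_mul' ?_ le_rfl
  calc ∫⁻ z, (pairCoord ⁻¹' S).indicator (fun _ => (1 : ℝ≥0∞)) z * sigmaDomXY A z ∂((volume : Measure ℍ).prod volume)
      ≤ ∫⁻ z, S.indicator (fun _ => (1 : ℝ≥0∞)) (pairCoord z) * FdomS A.re A.imI (pairCoord z) ∂((volume : Measure ℍ).prod volume) := by
        refine lintegral_mono fun z => ?_
        by_cases h : pairCoord z ∈ S
        · rw [indicator_of_mem (show z ∈ pairCoord ⁻¹' S from h), indicator_of_mem h, one_mul, one_mul]
          exact sigmaDomXY_le_FdomS A z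
        · rw [indicator_of_notMem (show z ∉ pairCoord ⁻¹' S from h), zero_mul]; exact bot_le
    _ = ∫⁻ u, S.indicator (fun _ => (1 : ℝ≥0∞)) u * FdomS A.re A.imI u :=
        measurePreserving_pairCoord.lintegral_comp ((measurable_const.indicator hS).mul (measurable_FdomS _ _))

/-- ★ **Transfer of a `z`-cut**: `∫ 𝟙{z ∈ Z}·sigmaDom A ≤ 4B(α,β)·(vol(Z ∩ zBox)·e⁴)` for an axial unit hub with `αβ ≠ 0`. [folklore] -/
theorem lintegral_zCut_sigmaDom_le {A : ℍ} (h1 : A.re ^ 2 + A.imI ^ 2 = 1) (hα : A.re ≠ 0) (hβ : A.imI ≠ 0) {Z : Set ℍ} (hZ : MeasurableSet Z) :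
    ∫⁻ w, {w : (ℍ × ℍ) × ℍ | w.2 ∈ Z}.indicator (fun _ => (1 : ℝ≥0∞)) w * sigmaDom A w ∂vol3 ≤
      4 * blockB A.re A.imI * (volume (Z ∩ zBox) * ENNReal.ofReal (Real.exp 4)) := by
  have hg : Measurable fun z : ℍ => Z.indicator (fun _ => (1 : ℝ≥0∞)) z * (zBox.indicator (fun _ => (1 : ℝ≥0∞)) z * ENNReal.ofReal (Real.exp 4)) :=
    (measurable_const.indicator hZ).mul ((measurable_const.indicator measurableSet_zBox).mul measurable_const)
  have e : ∀ w : (ℍ × ℍ) × ℍ, {w : (ℍ × ℍ) × ℍ | w.2 ∈ Z}.indicator (fun _ => (1 : ℝ≥0∞)) w * sigmaDom A w =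
      sigmaDomXY A w.1 * (Z.indicator (fun _ => (1 : ℝ≥0∞)) w.2 * (zBox.indicator (fun _ => (1 : ℝ≥0∞)) w.2 * ENNReal.ofReal (Real.exp 4))) := by
    intro w
    rw [sigmaDom_eq]
    have : {w : (ℍ × ℍ) × ℍ | w.2 ∈ Z}.indicator (fun _ => (1 : ℝ≥0∞)) w = Z.indicator (fun _ => (1 : ℝ≥0∞)) w.2 := by
      by_cases h : w.2 ∈ Z
      · rw [indicator_of_mem (show w ∈ {w : (ℍ × ℍ) × ℍ | w.2 ∈ Z} from h), indicator_of_mem h]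
      · rw [indicator_of_notMem (show w ∉ {w : (ℍ × ℍ) × ℍ | w.2 ∈ Z} from h), indicator_of_notMem h]
    rw [this]; ring
  simp_rw [e]
  rw [vol3_def, lintegral_prod_mul (measurable_sigmaDomXY A).aemeasurable hg.aemeasurable, lintegral_zFactor_eq hZ, blockB_def]
  exact mul_le_mul' (lintegral_sigmaDomXY_le h1 hα hβ) le_rfl

/-- In `zBox`, `‖ζ‖² = z_I² + z_J² + z_K² < 3`. [folklore] -/
theorem im_sq_lt_three_of_mem_zBox {z : ℍ} (hz : z ∈ zBox) : z.imI ^ 2 + z.imJ ^ 2 + z.imK ^ 2 < 3 := by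
  obtain ⟨-, h1, h2, h3⟩ := hz
  linarith

/-- ★ The slaved RATIO cut: `vol({c·z₀² < z_I²+z_J²+z_K²} ∩ zBox) ≤ 2√(3/c)·8` (`c > 0`). [folklore] -/
theorem volume_zRatio_inter_zBox_le {c : ℝ} (hc : 0 < c) :
    (volume : Measure ℍ) ({z : ℍ | c * z.re ^ 2 < z.imI ^ 2 + z.imJ ^ 2 + z.imK ^ 2} ∩ zBox) ≤ ENNReal.ofReal (2 * Real.sqrt (3 / c)) * 8 := by
  set B : Set (ℝ × (ℝ × (ℝ × ℝ))) := {u : ℝ | u ^ 2 < 3 / c} ×ˢ ({u : ℝ | u ^ 2 < 1} ×ˢ ({u : ℝ | u ^ 2 < 1} ×ˢ {u : ℝ | u ^ 2 < 1})) with hB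
  have hBm : MeasurableSet B := (measurableSet_lt (measurable_id.pow_const 2) measurable_const).prod
    (measurableSet_sqLine.prod (measurableSet_sqLine.prod measurableSet_sqLine))
  have hsub : {z : ℍ | c * z.re ^ 2 < z.imI ^ 2 + z.imJ ^ 2 + z.imK ^ 2} ∩ zBox ⊆ coord4 ⁻¹' B := by
    rintro z ⟨hzc, hzB⟩
    have h3 := im_sq_lt_three_of_mem_zBox hzB
    have hzc' : c * z.re ^ 2 < z.imI ^ 2 + z.imJ ^ 2 + z.imK ^ 2 := hzc
    obtain ⟨-, h1, h2, h3'⟩ := hzB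
    refine ⟨?_, h1, h2, h3'⟩
    show z.re ^ 2 < 3 / c
    rw [lt_div_iff₀ hc]; nlinarith
  calc (volume : Measure ℍ) ({z : ℍ | c * z.re ^ 2 < z.imI ^ 2 + z.imJ ^ 2 + z.imK ^ 2} ∩ zBox)
      ≤ volume (coord4 ⁻¹' B) := measure_mono hsub
    _ = volume B := measurePreserving_coord4.measure_preimage hBm.nullMeasurableSet
    _ = ENNReal.ofReal (2 * Real.sqrt (3 / c)) * 8 := by
        rw [hB, Measure.volume_eq_prod, Measure.prod_prod, Measure.volume_eq_prod, Measure.prod_prod, Measure.volume_eq_prod, Measure.prod_prod,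
          volume_sq_lt, volume_sqBox_one]
        norm_num

/-- ★ The slaved ball-flip LAYER: `vol({1 − s²‖ζ‖² ≤ z₀² < 1} ∩ zBox) ≤ 2√(3s²)·8`. [folklore] -/
theorem volume_zLayer_inter_zBox_le (s : ℝ) :
    (volume : Measure ℍ) ({z : ℍ | 1 - s ^ 2 * (z.imI ^ 2 + z.imJ ^ 2 + z.imK ^ 2) ≤ z.re ^ 2 ∧ z.re ^ 2 < 1} ∩ zBox) ≤
      ENNReal.ofReal (2 * (3 * s ^ 2) ^ (1 / 2 : ℝ)) * 8 := by
  set B : Set (ℝ × (ℝ × (ℝ × ℝ))) := Lset 0 (3 * s ^ 2) ×ˢ ({u : ℝ | u ^ 2 < 1} ×ˢ ({u : ℝ | u ^ 2 < 1} ×ˢ {u : ℝ | u ^ 2 < 1})) with hB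
  have hBm : MeasurableSet B := (measurableSet_Lset _ _).prod (measurableSet_sqLine.prod (measurableSet_sqLine.prod measurableSet_sqLine))
  have hsub : {z : ℍ | 1 - s ^ 2 * (z.imI ^ 2 + z.imJ ^ 2 + z.imK ^ 2) ≤ z.re ^ 2 ∧ z.re ^ 2 < 1} ∩ zBox ⊆ coord4 ⁻¹' B := by
    rintro z ⟨⟨hz1, hz2⟩, hzB⟩
    have h3 := im_sq_lt_three_of_mem_zBox hzB
    obtain ⟨-, h1, h2, h3'⟩ := hzB
    refine ⟨(mem_Lset 0 (3 * s ^ 2) z.re).2 ⟨by linarith, ?_⟩, h1, h2, h3'⟩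
    nlinarith [sq_nonneg s]
  calc (volume : Measure ℍ) ({z : ℍ | 1 - s ^ 2 * (z.imI ^ 2 + z.imJ ^ 2 + z.imK ^ 2) ≤ z.re ^ 2 ∧ z.re ^ 2 < 1} ∩ zBox)
      ≤ volume (coord4 ⁻¹' B) := measure_mono hsub
    _ = volume B := measurePreserving_coord4.measure_preimage hBm.nullMeasurableSet
    _ ≤ ENNReal.ofReal (2 * (3 * s ^ 2) ^ (1 / 2 : ℝ)) * 8 := by
        rw [hB, Measure.volume_eq_prod, Measure.prod_prod, Measure.volume_eq_prod, Measure.prod_prod, Measure.volume_eq_prod, Measure.prod_prod,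
          volume_sqBox_one]
        have hL := volume_Lset_le (a := 0) (ε := 3 * s ^ 2) (p := 1 / 2) le_rfl (by positivity) (by norm_num) le_rfl
        calc volume (Lset 0 (3 * s ^ 2)) * (2 * (2 * 2)) ≤ ENNReal.ofReal (2 * (3 * s ^ 2) ^ (1 / 2 : ℝ)) * (2 * (2 * 2)) := mul_le_mul' hL le_rfl
          _ = ENNReal.ofReal (2 * (3 * s ^ 2) ^ (1 / 2 : ℝ)) * 8 := by norm_num

/-! ## §M The eight pieces against the dominator -/

/-- ★★ **Small axial part of `x`**: `∫ 𝟙{x₀² + x_I² < ε²}·sigmaDom A ≤ 4ε·B·E` (`E = 16e⁴`). [folklore] -/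
theorem lintegral_pieceXS_le {A : ℍ} (h1 : A.re ^ 2 + A.imI ^ 2 = 1) (hα : A.re ≠ 0) (hβ : A.imI ≠ 0) {ε : ℝ} (hε : 0 ≤ ε) :
    ∫⁻ w, {w : (ℍ × ℍ) × ℍ | w.1.1.re ^ 2 + w.1.1.imI ^ 2 < ε ^ 2}.indicator (fun _ => (1 : ℝ≥0∞)) w * sigmaDom A w ∂vol3 ≤
      ENNReal.ofReal (4 * ε) * blockB A.re A.imI * (16 * ENNReal.ofReal (Real.exp 4)) := by
  have hS : MeasurableSet {u : (ℝ × ℝ) × ((ℝ × ℝ) × ((ℝ × ℝ) × (ℝ × ℝ))) | u.1.1 ^ 2 + u.2.1.1 ^ 2 < ε ^ 2} :=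
    measurableSet_lt (by fun_prop) measurable_const
  have e : {w : (ℍ × ℍ) × ℍ | w.1.1.re ^ 2 + w.1.1.imI ^ 2 < ε ^ 2} =
      {w : (ℍ × ℍ) × ℍ | pairCoord w.1 ∈ {u : (ℝ × ℝ) × ((ℝ × ℝ) × ((ℝ × ℝ) × (ℝ × ℝ))) | u.1.1 ^ 2 + u.2.1.1 ^ 2 < ε ^ 2}} := rfl
  rw [e]
  exact (lintegral_xyCut_sigmaDom_le A hS).trans (mul_le_mul' (lintegral_xSmall_frame_le h1 hα hβ hε) le_rfl)

/-- ★★ **Small axial part of `y`**: `∫ 𝟙{y₀² + y_I² < ε²}·sigmaDom A ≤ 4ε·B·E`. [folklore] -/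
theorem lintegral_pieceYS_le {A : ℍ} (h1 : A.re ^ 2 + A.imI ^ 2 = 1) (hα : A.re ≠ 0) (hβ : A.imI ≠ 0) {ε : ℝ} (hε : 0 ≤ ε) :
    ∫⁻ w, {w : (ℍ × ℍ) × ℍ | w.1.2.re ^ 2 + w.1.2.imI ^ 2 < ε ^ 2}.indicator (fun _ => (1 : ℝ≥0∞)) w * sigmaDom A w ∂vol3 ≤
      ENNReal.ofReal (4 * ε) * blockB A.re A.imI * (16 * ENNReal.ofReal (Real.exp 4)) := by
  have hS : MeasurableSet {u : (ℝ × ℝ) × ((ℝ × ℝ) × ((ℝ × ℝ) × (ℝ × ℝ))) | u.1.2 ^ 2 + u.2.1.2 ^ 2 < ε ^ 2} :=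
    measurableSet_lt (by fun_prop) measurable_const
  have e : {w : (ℍ × ℍ) × ℍ | w.1.2.re ^ 2 + w.1.2.imI ^ 2 < ε ^ 2} =
      {w : (ℍ × ℍ) × ℍ | pairCoord w.1 ∈ {u : (ℝ × ℝ) × ((ℝ × ℝ) × ((ℝ × ℝ) × (ℝ × ℝ))) | u.1.2 ^ 2 + u.2.1.2 ^ 2 < ε ^ 2}} := rfl
  rw [e]
  exact (lintegral_xyCut_sigmaDom_le A hS).trans (mul_le_mul' (lintegral_ySmall_frame_le h1 hα hβ hε) le_rfl)

/-- ★★ **Large transverse part of `x`** (Markov): `∫ 𝟙{T < x_J² + x_K²}·sigmaDom A ≤ 4T^{−p}·M_p·E` (`T > 0`, `0 < p ≤ 1`). [folklore] -/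
theorem lintegral_pieceXL_le {A : ℍ} (h1 : A.re ^ 2 + A.imI ^ 2 = 1) (hα : A.re ≠ 0) (hβ : A.imI ≠ 0) {T p : ℝ} (hT : 0 < T)
    (hp : 0 < p) (hp1 : p ≤ 1) :
    ∫⁻ w, {w : (ℍ × ℍ) × ℍ | T < w.1.1.imJ ^ 2 + w.1.1.imK ^ 2}.indicator (fun _ => (1 : ℝ≥0∞)) w * sigmaDom A w ∂vol3 ≤
      ENNReal.ofReal (4 * T ^ (-p)) * (2 * (ENNReal.ofReal ((4 / (A.re ^ 2 * A.imI ^ 4)) ^ p * 2) * blockB A.re A.imI)) *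
        (16 * ENNReal.ofReal (Real.exp 4)) := by
  have hS : MeasurableSet {u : (ℝ × ℝ) × ((ℝ × ℝ) × ((ℝ × ℝ) × (ℝ × ℝ))) | T < u.2.2.1.1 ^ 2 + u.2.2.2.1 ^ 2} :=
    measurableSet_lt measurable_const (by fun_prop)
  have e : {w : (ℍ × ℍ) × ℍ | T < w.1.1.imJ ^ 2 + w.1.1.imK ^ 2} =
      {w : (ℍ × ℍ) × ℍ | pairCoord w.1 ∈ {u : (ℝ × ℝ) × ((ℝ × ℝ) × ((ℝ × ℝ) × (ℝ × ℝ))) | T < u.2.2.1.1 ^ 2 + u.2.2.2.1 ^ 2}} := rfl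
  rw [e]
  exact (lintegral_xyCut_sigmaDom_le A hS).trans (mul_le_mul' (lintegral_xLarge_frame_le h1 hα hβ hT hp hp1) le_rfl)

/-- ★★ **Large transverse part of `y`**: `∫ 𝟙{T < y_J² + y_K²}·sigmaDom A ≤ 4T^{−p}·M_p·E`. [folklore] -/
theorem lintegral_pieceYL_le {A : ℍ} (h1 : A.re ^ 2 + A.imI ^ 2 = 1) (hα : A.re ≠ 0) (hβ : A.imI ≠ 0) {T p : ℝ} (hT : 0 < T)
    (hp : 0 < p) (hp1 : p ≤ 1) :
    ∫⁻ w, {w : (ℍ × ℍ) × ℍ | T < w.1.2.imJ ^ 2 + w.1.2.imK ^ 2}.indicator (fun _ => (1 : ℝ≥0∞)) w * sigmaDom A w ∂vol3 ≤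
      ENNReal.ofReal (4 * T ^ (-p)) * (2 * (ENNReal.ofReal ((4 / (A.re ^ 2 * A.imI ^ 4)) ^ p * 2) * blockB A.re A.imI)) *
        (16 * ENNReal.ofReal (Real.exp 4)) := by
  have hS : MeasurableSet {u : (ℝ × ℝ) × ((ℝ × ℝ) × ((ℝ × ℝ) × (ℝ × ℝ))) | T < u.2.2.1.2 ^ 2 + u.2.2.2.2 ^ 2} :=
    measurableSet_lt measurable_const (by fun_prop)
  have e : {w : (ℍ × ℍ) × ℍ | T < w.1.2.imJ ^ 2 + w.1.2.imK ^ 2} =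
      {w : (ℍ × ℍ) × ℍ | pairCoord w.1 ∈ {u : (ℝ × ℝ) × ((ℝ × ℝ) × ((ℝ × ℝ) × (ℝ × ℝ))) | T < u.2.2.1.2 ^ 2 + u.2.2.2.2 ^ 2}} := rfl
  rw [e]
  exact (lintegral_xyCut_sigmaDom_le A hS).trans (mul_le_mul' (lintegral_yLarge_frame_le h1 hα hβ hT hp hp1) le_rfl)

/-- ★★ **Ball-flip layer of `x`**: `∫ 𝟙{1 − s²(x_J²+x_K²) ≤ x₀²+x_I² < 1}·sigmaDom A ≤ 4(s²)^p·M_p·E` (`0 < p ≤ 1/2`). [folklore] -/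
theorem lintegral_pieceXLayer_le {A : ℍ} (h1 : A.re ^ 2 + A.imI ^ 2 = 1) (hα : A.re ≠ 0) (hβ : A.imI ≠ 0) (s : ℝ) {p : ℝ}
    (hp : 0 < p) (hp2 : p ≤ 1 / 2) :
    ∫⁻ w, {w : (ℍ × ℍ) × ℍ | 1 - s ^ 2 * (w.1.1.imJ ^ 2 + w.1.1.imK ^ 2) ≤ w.1.1.re ^ 2 + w.1.1.imI ^ 2 ∧
        w.1.1.re ^ 2 + w.1.1.imI ^ 2 < 1}.indicator (fun _ => (1 : ℝ≥0∞)) w * sigmaDom A w ∂vol3 ≤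
      ENNReal.ofReal (4 * (s ^ 2) ^ p) * (2 * (ENNReal.ofReal ((4 / (A.re ^ 2 * A.imI ^ 4)) ^ p * 2) * blockB A.re A.imI)) *
        (16 * ENNReal.ofReal (Real.exp 4)) := by
  have hS : MeasurableSet {u : (ℝ × ℝ) × ((ℝ × ℝ) × ((ℝ × ℝ) × (ℝ × ℝ))) | 1 - s ^ 2 * (u.2.2.1.1 ^ 2 + u.2.2.2.1 ^ 2) ≤ u.1.1 ^ 2 + u.2.1.1 ^ 2 ∧
      u.1.1 ^ 2 + u.2.1.1 ^ 2 < 1} := by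
    rw [Set.setOf_and]; exact (measurableSet_le (by fun_prop) (by fun_prop)).inter (measurableSet_lt (by fun_prop) measurable_const)
  have e : {w : (ℍ × ℍ) × ℍ | 1 - s ^ 2 * (w.1.1.imJ ^ 2 + w.1.1.imK ^ 2) ≤ w.1.1.re ^ 2 + w.1.1.imI ^ 2 ∧ w.1.1.re ^ 2 + w.1.1.imI ^ 2 < 1} =
      {w : (ℍ × ℍ) × ℍ | pairCoord w.1 ∈ {u : (ℝ × ℝ) × ((ℝ × ℝ) × ((ℝ × ℝ) × (ℝ × ℝ))) |
        1 - s ^ 2 * (u.2.2.1.1 ^ 2 + u.2.2.2.1 ^ 2) ≤ u.1.1 ^ 2 + u.2.1.1 ^ 2 ∧ u.1.1 ^ 2 + u.2.1.1 ^ 2 < 1}} := rfl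
  rw [e]
  exact (lintegral_xyCut_sigmaDom_le A hS).trans (mul_le_mul' (lintegral_xLayer_frame_le h1 hα hβ s hp hp2) le_rfl)

/-- ★★ **Ball-flip layer of `y`**: `∫ 𝟙{1 − s²(y_J²+y_K²) ≤ y₀²+y_I² < 1}·sigmaDom A ≤ 4(s²)^p·M_p·E`. [folklore] -/
theorem lintegral_pieceYLayer_le {A : ℍ} (h1 : A.re ^ 2 + A.imI ^ 2 = 1) (hα : A.re ≠ 0) (hβ : A.imI ≠ 0) (s : ℝ) {p : ℝ}
    (hp : 0 < p) (hp2 : p ≤ 1 / 2) :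
    ∫⁻ w, {w : (ℍ × ℍ) × ℍ | 1 - s ^ 2 * (w.1.2.imJ ^ 2 + w.1.2.imK ^ 2) ≤ w.1.2.re ^ 2 + w.1.2.imI ^ 2 ∧
        w.1.2.re ^ 2 + w.1.2.imI ^ 2 < 1}.indicator (fun _ => (1 : ℝ≥0∞)) w * sigmaDom A w ∂vol3 ≤
      ENNReal.ofReal (4 * (s ^ 2) ^ p) * (2 * (ENNReal.ofReal ((4 / (A.re ^ 2 * A.imI ^ 4)) ^ p * 2) * blockB A.re A.imI)) *
        (16 * ENNReal.ofReal (Real.exp 4)) := by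
  have hS : MeasurableSet {u : (ℝ × ℝ) × ((ℝ × ℝ) × ((ℝ × ℝ) × (ℝ × ℝ))) | 1 - s ^ 2 * (u.2.2.1.2 ^ 2 + u.2.2.2.2 ^ 2) ≤ u.1.2 ^ 2 + u.2.1.2 ^ 2 ∧
      u.1.2 ^ 2 + u.2.1.2 ^ 2 < 1} := by
    rw [Set.setOf_and]; exact (measurableSet_le (by fun_prop) (by fun_prop)).inter (measurableSet_lt (by fun_prop) measurable_const)
  have e : {w : (ℍ × ℍ) × ℍ | 1 - s ^ 2 * (w.1.2.imJ ^ 2 + w.1.2.imK ^ 2) ≤ w.1.2.re ^ 2 + w.1.2.imI ^ 2 ∧ w.1.2.re ^ 2 + w.1.2.imI ^ 2 < 1} =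
      {w : (ℍ × ℍ) × ℍ | pairCoord w.1 ∈ {u : (ℝ × ℝ) × ((ℝ × ℝ) × ((ℝ × ℝ) × (ℝ × ℝ))) |
        1 - s ^ 2 * (u.2.2.1.2 ^ 2 + u.2.2.2.2 ^ 2) ≤ u.1.2 ^ 2 + u.2.1.2 ^ 2 ∧ u.1.2 ^ 2 + u.2.1.2 ^ 2 < 1}} := rfl
  rw [e]
  exact (lintegral_xyCut_sigmaDom_le A hS).trans (mul_le_mul' (lintegral_yLayer_frame_le h1 hα hβ s hp hp2) le_rfl)

/-- ★★ **Slaved ratio cut**: `∫ 𝟙{c·z₀² < ‖ζ‖²}·sigmaDom A ≤ 4B·(2√(3/c)·8)·e⁴` (`c > 0`). [folklore] -/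
theorem lintegral_pieceZC_le {A : ℍ} (h1 : A.re ^ 2 + A.imI ^ 2 = 1) (hα : A.re ≠ 0) (hβ : A.imI ≠ 0) {c : ℝ} (hc : 0 < c) :
    ∫⁻ w, {w : (ℍ × ℍ) × ℍ | c * w.2.re ^ 2 < w.2.imI ^ 2 + w.2.imJ ^ 2 + w.2.imK ^ 2}.indicator (fun _ => (1 : ℝ≥0∞)) w * sigmaDom A w ∂vol3 ≤
      4 * blockB A.re A.imI * (ENNReal.ofReal (2 * Real.sqrt (3 / c)) * 8 * ENNReal.ofReal (Real.exp 4)) := by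
  have hZ : MeasurableSet {z : ℍ | c * z.re ^ 2 < z.imI ^ 2 + z.imJ ^ 2 + z.imK ^ 2} := measurableSet_lt (by fun_prop) (by fun_prop)
  have e : {w : (ℍ × ℍ) × ℍ | c * w.2.re ^ 2 < w.2.imI ^ 2 + w.2.imJ ^ 2 + w.2.imK ^ 2} =
      {w : (ℍ × ℍ) × ℍ | w.2 ∈ {z : ℍ | c * z.re ^ 2 < z.imI ^ 2 + z.imJ ^ 2 + z.imK ^ 2}} := rfl
  rw [e]
  refine (lintegral_zCut_sigmaDom_le h1 hα hβ hZ).trans (mul_le_mul' le_rfl (mul_le_mul' (volume_zRatio_inter_zBox_le hc) le_rfl))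

/-- ★★ **Slaved ball-flip layer**: `∫ 𝟙{1 − s²‖ζ‖² ≤ z₀² < 1}·sigmaDom A ≤ 4B·(2√(3s²)·8)·e⁴`. [folklore] -/
theorem lintegral_pieceZLayer_le {A : ℍ} (h1 : A.re ^ 2 + A.imI ^ 2 = 1) (hα : A.re ≠ 0) (hβ : A.imI ≠ 0) (s : ℝ) :
    ∫⁻ w, {w : (ℍ × ℍ) × ℍ | 1 - s ^ 2 * (w.2.imI ^ 2 + w.2.imJ ^ 2 + w.2.imK ^ 2) ≤ w.2.re ^ 2 ∧ w.2.re ^ 2 < 1}.indicator (fun _ => (1 : ℝ≥0∞)) w *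
        sigmaDom A w ∂vol3 ≤
      4 * blockB A.re A.imI * (ENNReal.ofReal (2 * (3 * s ^ 2) ^ (1 / 2 : ℝ)) * 8 * ENNReal.ofReal (Real.exp 4)) := by
  have hZ : MeasurableSet {z : ℍ | 1 - s ^ 2 * (z.imI ^ 2 + z.imJ ^ 2 + z.imK ^ 2) ≤ z.re ^ 2 ∧ z.re ^ 2 < 1} := by
    rw [Set.setOf_and]; exact (measurableSet_le (by fun_prop) (by fun_prop)).inter (measurableSet_lt (by fun_prop) measurable_const)
  have e : {w : (ℍ × ℍ) × ℍ | 1 - s ^ 2 * (w.2.imI ^ 2 + w.2.imJ ^ 2 + w.2.imK ^ 2) ≤ w.2.re ^ 2 ∧ w.2.re ^ 2 < 1} =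
      {w : (ℍ × ℍ) × ℍ | w.2 ∈ {z : ℍ | 1 - s ^ 2 * (z.imI ^ 2 + z.imJ ^ 2 + z.imK ^ 2) ≤ z.re ^ 2 ∧ z.re ^ 2 < 1}} := rfl
  rw [e]
  refine (lintegral_zCut_sigmaDom_le h1 hα hβ hZ).trans (mul_le_mul' le_rfl (mul_le_mul' (volume_zLayer_inter_zBox_le s) le_rfl))

end Summit.QuantumFields.YangMills.Theorems.SwapVirialDeficit.ZeroModeSigma

end
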